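import Literature.Algebra.Lie.LefschetzModuleKleimanAlgebraMatrix
import Literature.Algebra.Lie.LefschetzSl2Type
import HarnessLib

/-!
# The matrices of `h`, `ᶜΛ`, `*_L`, `*_H` under André's isomorphism, and the comparison isomorphism
# `K[L, *_L] ≅ K[L', *_L']` for two cohomologies with the same Betti numbers (André 1996, Prop. 1.2 and the Remark after it)

Topic `Literature/Algebra/Lie` (namespace `Literature.Algebra.Lie`).  Lane `lit-hodgefound` (Track 2 foundations library),
prover seat `lit-hodgefound-p34` (generation 30, row g30-#7), a sequel of row g30-#5 (`LefschetzModuleKleimanAlgebraMatrix.lean`: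
André's canonical `Φ = matrixHom : (Π_{k ∈ stringTypes} M_{k+1}(K)) →ₐ End M`, injective with range `K[e, ᶜΛ]`, `matrixEquiv`,
`Φ(sub-diagonal) = e`, `Φ(super-diagonal) = *_L e *_L`).  DEFINITIONS WITH BODIES (`matrixFamilyCongr`, `kleimanAlgebraCongr`)
and PROVED theorems only (no named fact, no `sorry`, no instance, no notation; net debt `0`).

## Source, VERBATIM

Y. André, *Pour une théorie inconditionnelle des motifs*, Publ. Math. IHÉS **83** (1996) [Andre1996Motifs] (held
`paper:doi-10-1007-bf02698643`), p. 12 (= p0009 L16–L33), the Remark after Prop. 1.2: "Remarque. — Si `H'` est une autre théorie de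
cohomologie à coefficients dans un corps `F'` vérifiant le théorème de Lefschetz fort et ayant les mêmes nombres de Betti que `H`
(ce qui est le cas en particulier si `H` et `H'` satisfont au théorème de Lefschetz faible), et si `L'` désigne l'opérateur de Lefschetz
défini par le même faisceau inversible ample, on a un triangle commutatif d'isomorphismes `ℚ[L, *_L] → ℚ[L', *_{L'}]` over
`⊕ M_{i+1}(ℚ)`, où la flèche verticale est donnée par `L ↦ L'`, `*_L ↦ *_{L'}`, et où les flèches obliques sont données par la
proposition.  En effet, l'hypothèse sur `H'` entraîne que `dim Pⁱ(X) = dim P'ⁱ(X)`, et l'on peut alors construire (en reprenant les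
notations de la preuve ci-dessus) un isomorphisme de `𝔰𝔩₂`-modules `H_ℚ ≅ H'_ℚ` […]."  Together with the matrices of Prop. 1.2's proof
(p0009 L11–L13): "l'image de `L` (resp. `*_L L *_L`) dans chaque `M_{i+1}(ℚ)` soit la matrice `(m_{ij})` définie par `m_{ij} = 1` si
`i = j + 1` (resp. `i = j - 1`), et `= 0` sinon" — completed here by the matrices of `h`, `ᶜΛ` (§1.1: "`ᶜΛ x = Σ k(d-i+k+1) L^{k-1} x_{i-2k}`"),
`*_L` and `*_H`.

## Rendering (dictionary, continuing g30-#5)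

* "une autre théorie de cohomologie […] mêmes nombres de Betti": a second Lefschetz module `(M', h', e')` over the same field with
  `dim M'_m = dim M_m` for every degree `m` (`finrank K (degreeSpace h' m) = finrank K (degreeSpace h m)`); "entraîne que
  `dim Pⁱ(X) = dim P'ⁱ(X)`": `stringTypes_eq_of_finrank_degreeSpace_eq` (via skel-1's A1-113 `finrank_degreeSpace_neg_eq_add`:
  `dim M_{-k} = dim P_{-k} + dim M_{-k-2}`), so in particular the same string lengths occur: `stringTypes h e = stringTypes h' e'` —
  the only hypothesis the construction needs.
* "la flèche verticale […] `L ↦ L'`, `*_L ↦ *_{L'}`": the algebra isomorphism `kleimanAlgebraCongr : K[e, ᶜΛ] ≃ₐ[K] K[e', ᶜΛ']`, the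
  composite of the two oblique arrows `matrixEquiv` through the reindexing `matrixFamilyCongr` of matrix families; it maps `e ↦ e'`
  (`coe_kleimanAlgebraCongr_e`), `*_L ↦ *_{L'}` (`coe_kleimanAlgebraCongr_lefschetzInvolution`), and also `h ↦ h'`, `ᶜΛ ↦ ᶜΛ'`,
  `*_H ↦ *_{H'}`, `*_L e *_L ↦ *_{L'} e' *_{L'}` — because each of these operators is `Φ` of a matrix family written uniformly in the
  string length (§1).

## Contents (all proved unless marked def)

* §1 matrices under `Φ`: **`matrixHom_diag`** (`Φ(diag(2a - k)) = h`), **`matrixHom_dualMatrix`** (`Φ((a+1)(k-a) on the super-diagonal) = ᶜΛ`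
  — André's coefficients), **`matrixHom_antidiag`** (`Φ(anti-diagonal) = *_L`), **`matrixHom_antidiag_smul`** (`Φ(ε_k · anti-diagonal) = *_H`).
* §2 (def) `matrixFamilyCongr` (reindexing along `stringTypes h e = stringTypes h' e'`), `matrixFamilyCongr_apply`,
  `matrixEquiv_symm_apply_eq`, (def) **`kleimanAlgebraCongr`** (André's vertical arrow), `coe_kleimanAlgebraCongr_apply`,
  **`coe_kleimanAlgebraCongr_e`**, **`coe_kleimanAlgebraCongr_lefschetzInvolution`**, `coe_kleimanAlgebraCongr_conj_lefschetzInvolution`,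
  `coe_kleimanAlgebraCongr_h`, `coe_kleimanAlgebraCongr_dual`, `coe_kleimanAlgebraCongr_hodgeInvolution`.
* §3 "mêmes nombres de Betti": `finrank_primitiveSpace_eq_sub`, **`stringTypes_eq_of_finrank_primitiveSpace_eq`**,
  **`stringTypes_eq_of_finrank_degreeSpace_eq`**.
* §4 "donnée par `L ↦ L'`, `*_L ↦ *_{L'}`" (uniqueness): `adjoin_preimage_val_eq_top`, `algHom_ext_of_apply_pair_eq`,
  `algHom_ext_of_apply_e_lefschetzInvolution_eq` (an algebra map out of `K[e, ᶜΛ]` is determined by `e` and `*_L`),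
  **`kleimanAlgebraCongr_unique`** / `kleimanAlgebraCongr_unique'`.

## References

* [Andre1996Motifs] Y. André, *Pour une théorie inconditionnelle des motifs*, Publ. Math. IHÉS 83 (1996) 5–49, Prop. 1.2, its proof and
  the Remark after it (pp. 11–12); §1.1 (formula for `ᶜΛ`).
* [Kleiman1968AlgebraicCycles] S. L. Kleiman, *Algebraic cycles and the Weil conjectures* (1968), §1.4 (1.4.4–1.4.6) — via André.
* [LooijengaLunts1997] E. Looijenga, V. A. Lunts, *A Lie algebra attached to a projective variety*, Invent. Math. 129 (1997), §1 (1.15).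
-/

noncomputable section

namespace Literature.Algebra.Lie

open Module Function Set
open HasLefschetzProperty (primitiveSpace mem_primitiveSpace_iff)

variable {K : Type*} [Field K] [CharZero K] {M : Type*} [AddCommGroup M] [Module K M] [FiniteDimensional K M]
  {h e : Module.End K M}

namespace HasLefschetzProperty

/-! ### §1 The matrices of `h`, `ᶜΛ`, `*_L`, `*_H` under `Φ` -/

/-- **`Φ(diag(2a - k)_k) = h`**: on the string `p, e p, …, eᵏ p` the degree operator is diagonal with entries `-k, -k+2, …, k`.
[cite: Andre1996Motifs, Prop. 1.2 (p. 12, proof: "en identifiant ℚ^{i+1} à la puissance symétrique i-ème de la représentation standard")] -/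
theorem matrixHom_diag (L : HasLefschetzProperty h e) (hgr : IsZGrading h) :
    L.matrixHom hgr (fun k a b ↦ if a = b then 2 * (a : K) - (k : ℕ) else 0) = h := by
  rw [matrixHom_apply]
  refine L.linearMap_ext_of_strings hgr fun k p hp j hj ↦ ?_
  by_cases hk : k ∈ stringTypes h e
  · rw [L.matrixLinearMap_apply_pow_primitive hgr _ hk hp hj,
      mem_degreeSpace_iff.1 (L.pow_apply_mem (mem_primitiveSpace_iff.1 hp).1 j),
      Finset.sum_eq_single_of_mem (⟨j, Nat.lt_succ_of_le hj⟩ : Fin (k + 1)) (Finset.mem_univ _) fun a _ ha ↦ by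
        rw [if_neg ha, zero_smul]]
    rw [if_pos rfl]
    push_cast
    ring_nf
  · rw [L.eq_zero_of_not_mem_stringTypes hk hp, map_zero, map_zero, map_zero]

/-- **`Φ` of André's coefficients is `ᶜΛ`**: the family with `(a + 1)(k - a)` at `(a, a + 1)` and `0` elsewhere maps to `ᶜΛ = L.dual`
(`ᶜΛ (e^{j+1} p) = (j+1)(k-j) eʲ p`, A1-88 `dual_apply_pow_primitive`). [cite: Andre1996Motifs, §1.1 (formula for ᶜΛ) and Prop. 1.2 (p. 12)]
[cite: Kleiman1968AlgebraicCycles, §1.4, 1.4.6] -/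
theorem matrixHom_dualMatrix (L : HasLefschetzProperty h e) (hgr : IsZGrading h) :
    L.matrixHom hgr (fun k a b ↦ if (b : ℕ) = (a : ℕ) + 1 then ((a : K) + 1) * ((k : ℕ) - (a : K)) else 0) = L.dual hgr := by
  rw [matrixHom_apply]
  refine L.linearMap_ext_of_strings hgr fun k p hp j hj ↦ ?_
  by_cases hk : k ∈ stringTypes h e
  · rw [L.matrixLinearMap_apply_pow_primitive hgr _ hk hp hj]
    rcases j with _ | j
    · rw [pow_zero, Module.End.one_apply, L.dual_apply_primitive hgr hp]
      exact Finset.sum_eq_zero fun a _ ↦ by rw [if_neg (fun h' ↦ by have h3 : 0 = (a : ℕ) + 1 := h'; omega), zero_smul]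
    · rw [L.dual_apply_pow_primitive hgr hp j,
        Finset.sum_eq_single_of_mem (⟨j, by omega⟩ : Fin (k + 1)) (Finset.mem_univ _) fun a _ ha ↦ by
          rw [if_neg fun h' ↦ ha (Fin.ext (show (a : ℕ) = j by have h3 : j + 1 = (a : ℕ) + 1 := h'; omega)), zero_smul]]
      rw [if_pos (show j + 1 = j + 1 from rfl)]
      congr 1
      have hjk : j ≤ k := by omega
      push_cast [hjk]
      ring
  · rw [L.eq_zero_of_not_mem_stringTypes hk hp, map_zero, map_zero, map_zero]

/-- **`Φ(anti-diagonal) = *_L`**: the family with `1` at `(a, b)`, `a + b = k`, maps to the Lefschetz involution (`*_L (eʲ p) = e^{k-j} p`).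
[cite: Andre1996Motifs, Prop. 1.2 (p. 12) and §1.1 (*_L)] -/
theorem matrixHom_antidiag (L : HasLefschetzProperty h e) (hgr : IsZGrading h) :
    L.matrixHom hgr (fun k a b ↦ if (a : ℕ) + (b : ℕ) = (k : ℕ) then 1 else 0) = L.lefschetzInvolution hgr := by
  rw [matrixHom_apply]
  refine L.linearMap_ext_of_strings hgr fun k p hp j hj ↦ ?_
  by_cases hk : k ∈ stringTypes h e
  · rw [L.matrixLinearMap_apply_pow_primitive hgr _ hk hp hj, L.isStringReversal_lefschetzInvolution hgr hp hj,
      Finset.sum_eq_single_of_mem (⟨k - j, by omega⟩ : Fin (k + 1)) (Finset.mem_univ _) fun a _ ha ↦ by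
        rw [if_neg fun h' ↦ ha (Fin.ext (show (a : ℕ) = k - j by have h3 : (a : ℕ) + j = k := h'; omega)), zero_smul]]
    rw [if_pos (show (k - j) + j = k by omega), one_smul]
  · rw [L.eq_zero_of_not_mem_stringTypes hk hp, map_zero, map_zero, map_zero]

/-- **`Φ(ε_k · anti-diagonal) = *_H`** with `ε_k = (-1)^{(d-k)(d-k+1)/2}` (`*_H (eʲ p) = ε_k e^{k-j} p`, row g29-#3).
[cite: Andre1996Motifs, Prop. 1.2 (p. 12) and §1.1 (*_H)] -/
theorem matrixHom_antidiag_smul (L : HasLefschetzProperty h e) (hgr : IsZGrading h) (d : ℕ) :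
    L.matrixHom hgr (fun k a b ↦ if (a : ℕ) + (b : ℕ) = (k : ℕ) then (-1 : K) ^ ((d - k) * (d - k + 1) / 2) else 0) =
      L.hodgeInvolution hgr d := by
  rw [matrixHom_apply]
  refine L.linearMap_ext_of_strings hgr fun k p hp j hj ↦ ?_
  by_cases hk : k ∈ stringTypes h e
  · rw [L.matrixLinearMap_apply_pow_primitive hgr _ hk hp hj, L.hodgeInvolution_apply_pow_primitive hgr d hp hj,
      Finset.sum_eq_single_of_mem (⟨k - j, by omega⟩ : Fin (k + 1)) (Finset.mem_univ _) fun a _ ha ↦ by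
        rw [if_neg fun h' ↦ ha (Fin.ext (show (a : ℕ) = k - j by have h3 : (a : ℕ) + j = k := h'; omega)), zero_smul]]
    rw [if_pos (show (k - j) + j = k by omega)]
  · rw [L.eq_zero_of_not_mem_stringTypes hk hp, map_zero, map_zero, map_zero]

/-! ### §2 André's comparison isomorphism `K[L, *_L] ≅ K[L', *_{L'}]` -/

/-- **Reindexing matrix families** along an equality `s = t` of index sets of string lengths (the identity, up to the type change).
[cite: Andre1996Motifs, Remark after Prop. 1.2 (p. 12)] -/
def matrixFamilyCongr {s t : Finset ℕ} (hst : s = t) :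
    ((k : s) → Matrix (Fin ((k : ℕ) + 1)) (Fin ((k : ℕ) + 1)) K) ≃ₐ[K]
      ((k : t) → Matrix (Fin ((k : ℕ) + 1)) (Fin ((k : ℕ) + 1)) K) where
  toFun c k := c ⟨k, hst ▸ k.2⟩
  invFun c k := c ⟨k, hst ▸ k.2⟩
  left_inv _ := rfl
  right_inv _ := rfl
  map_mul' _ _ := rfl
  map_add' _ _ := rfl
  commutes' _ := rfl

omit [CharZero K] [FiniteDimensional K M] in
/-- `matrixFamilyCongr` evaluates a family at the same string length. [cite: Andre1996Motifs, Remark after Prop. 1.2 (p. 12)] -/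
theorem matrixFamilyCongr_apply {s t : Finset ℕ} (hst : s = t)
    (c : (k : s) → Matrix (Fin ((k : ℕ) + 1)) (Fin ((k : ℕ) + 1)) K) (k : t) :
    matrixFamilyCongr (K := K) hst c k = c ⟨k, hst ▸ k.2⟩ := rfl

/-- The inverse oblique arrow: if `Φ(c) = x` then `matrixEquiv⁻¹ x = c`. [cite: Andre1996Motifs, Prop. 1.2 (p. 11)] -/
theorem matrixEquiv_symm_apply_eq (L : HasLefschetzProperty h e) (hgr : IsZGrading h)
    {c : (k : stringTypes h e) → Matrix (Fin ((k : ℕ) + 1)) (Fin ((k : ℕ) + 1)) K}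
    {x : ↥(Algebra.adjoin K ({e, L.dual hgr} : Set (Module.End K M)))} (hc : L.matrixHom hgr c = x) :
    (L.matrixEquiv hgr).symm x = c := by
  rw [AlgEquiv.symm_apply_eq]
  exact Subtype.ext (by rw [coe_matrixEquiv_apply, hc])

variable {M' : Type*} [AddCommGroup M'] [Module K M'] [FiniteDimensional K M'] {h' e' : Module.End K M'}

/-- **ANDRÉ'S COMPARISON ISOMORPHISM `K[L, *_L] ≅ K[L', *_{L'}]`** ("la flèche verticale") for two Lefschetz modules in which the same
string lengths occur: the composite of the oblique arrows `K[e, ᶜΛ] ≅ Π M_{k+1}(K) ≅ K[e', ᶜΛ']`.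
[cite: Andre1996Motifs, Remark after Prop. 1.2 (p. 12)] -/
def kleimanAlgebraCongr (L : HasLefschetzProperty h e) (hgr : IsZGrading h) (L' : HasLefschetzProperty h' e')
    (hgr' : IsZGrading h') (hst : stringTypes h e = stringTypes h' e') :
    ↥(Algebra.adjoin K ({e, L.dual hgr} : Set (Module.End K M))) ≃ₐ[K]
      ↥(Algebra.adjoin K ({e', L'.dual hgr'} : Set (Module.End K M'))) :=
  ((L.matrixEquiv hgr).symm.trans (matrixFamilyCongr hst)).trans (L'.matrixEquiv hgr')

/-- The comparison isomorphism on `Φ(c)` is `Φ'` of the reindexed family. [cite: Andre1996Motifs, Remark after Prop. 1.2 (p. 12)] -/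
theorem coe_kleimanAlgebraCongr_apply (L : HasLefschetzProperty h e) (hgr : IsZGrading h) (L' : HasLefschetzProperty h' e')
    (hgr' : IsZGrading h') (hst : stringTypes h e = stringTypes h' e')
    {c : (k : stringTypes h e) → Matrix (Fin ((k : ℕ) + 1)) (Fin ((k : ℕ) + 1)) K}
    {x : ↥(Algebra.adjoin K ({e, L.dual hgr} : Set (Module.End K M)))} (hc : L.matrixHom hgr c = x) :
    (L.kleimanAlgebraCongr hgr L' hgr' hst x : Module.End K M') = L'.matrixHom hgr' (matrixFamilyCongr hst c) := by
  rw [kleimanAlgebraCongr, AlgEquiv.trans_apply, AlgEquiv.trans_apply, L.matrixEquiv_symm_apply_eq hgr hc, coe_matrixEquiv_apply]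

/-- **"`L ↦ L'`".** [cite: Andre1996Motifs, Remark after Prop. 1.2 (p. 12)] -/
theorem coe_kleimanAlgebraCongr_e (L : HasLefschetzProperty h e) (hgr : IsZGrading h) (L' : HasLefschetzProperty h' e')
    (hgr' : IsZGrading h') (hst : stringTypes h e = stringTypes h' e') :
    (L.kleimanAlgebraCongr hgr L' hgr' hst ⟨e, Algebra.subset_adjoin (Set.mem_insert _ _)⟩ : Module.End K M') = e' := by
  rw [L.coe_kleimanAlgebraCongr_apply hgr L' hgr' hst (L.matrixHom_subdiag hgr)]
  exact L'.matrixHom_subdiag hgr'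

/-- **"`*_L ↦ *_{L'}`".** [cite: Andre1996Motifs, Remark after Prop. 1.2 (p. 12)] -/
theorem coe_kleimanAlgebraCongr_lefschetzInvolution (L : HasLefschetzProperty h e) (hgr : IsZGrading h)
    (L' : HasLefschetzProperty h' e') (hgr' : IsZGrading h') (hst : stringTypes h e = stringTypes h' e') :
    (L.kleimanAlgebraCongr hgr L' hgr' hst ⟨L.lefschetzInvolution hgr, L.lefschetzInvolution_mem_adjoin_pair_dual hgr⟩ :
      Module.End K M') = L'.lefschetzInvolution hgr' := by
  rw [L.coe_kleimanAlgebraCongr_apply hgr L' hgr' hst (L.matrixHom_antidiag hgr)]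
  exact L'.matrixHom_antidiag hgr'

/-- `*_L e *_L ↦ *_{L'} e' *_{L'}`. [cite: Andre1996Motifs, Remark after Prop. 1.2 (p. 12)] -/
theorem coe_kleimanAlgebraCongr_conj_lefschetzInvolution (L : HasLefschetzProperty h e) (hgr : IsZGrading h)
    (L' : HasLefschetzProperty h' e') (hgr' : IsZGrading h') (hst : stringTypes h e = stringTypes h' e') :
    (L.kleimanAlgebraCongr hgr L' hgr' hst ⟨L.lefschetzInvolution hgr * e * L.lefschetzInvolution hgr,
        L.conj_lefschetzInvolution_mem_adjoin_pair_dual hgr⟩ : Module.End K M') =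
      L'.lefschetzInvolution hgr' * e' * L'.lefschetzInvolution hgr' := by
  rw [L.coe_kleimanAlgebraCongr_apply hgr L' hgr' hst (L.matrixHom_superdiag hgr)]
  exact L'.matrixHom_superdiag hgr'

/-- `h ↦ h'`. [cite: Andre1996Motifs, Remark after Prop. 1.2 (p. 12)] -/
theorem coe_kleimanAlgebraCongr_h (L : HasLefschetzProperty h e) (hgr : IsZGrading h) (L' : HasLefschetzProperty h' e')
    (hgr' : IsZGrading h') (hst : stringTypes h e = stringTypes h' e') :
    (L.kleimanAlgebraCongr hgr L' hgr' hst ⟨h, L.h_mem_adjoin_pair_dual hgr⟩ : Module.End K M') = h' := by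
  rw [L.coe_kleimanAlgebraCongr_apply hgr L' hgr' hst (L.matrixHom_diag hgr)]
  exact L'.matrixHom_diag hgr'

/-- `ᶜΛ ↦ ᶜΛ'`. [cite: Andre1996Motifs, Remark after Prop. 1.2 (p. 12)] -/
theorem coe_kleimanAlgebraCongr_dual (L : HasLefschetzProperty h e) (hgr : IsZGrading h) (L' : HasLefschetzProperty h' e')
    (hgr' : IsZGrading h') (hst : stringTypes h e = stringTypes h' e') :
    (L.kleimanAlgebraCongr hgr L' hgr' hst ⟨L.dual hgr, Algebra.subset_adjoin (Set.mem_insert_of_mem _ rfl)⟩ :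
      Module.End K M') = L'.dual hgr' := by
  rw [L.coe_kleimanAlgebraCongr_apply hgr L' hgr' hst (L.matrixHom_dualMatrix hgr)]
  exact L'.matrixHom_dualMatrix hgr'

/-- `*_H ↦ *_{H'}` (same `d`). [cite: Andre1996Motifs, Remark after Prop. 1.2 (p. 12)] -/
theorem coe_kleimanAlgebraCongr_hodgeInvolution (L : HasLefschetzProperty h e) (hgr : IsZGrading h)
    (L' : HasLefschetzProperty h' e') (hgr' : IsZGrading h') (hst : stringTypes h e = stringTypes h' e') (d : ℕ) :
    (L.kleimanAlgebraCongr hgr L' hgr' hst ⟨L.hodgeInvolution hgr d, L.hodgeInvolution_mem_adjoin_pair_dual hgr d⟩ :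
      Module.End K M') = L'.hodgeInvolution hgr' d := by
  rw [L.coe_kleimanAlgebraCongr_apply hgr L' hgr' hst (L.matrixHom_antidiag_smul hgr d)]
  exact L'.matrixHom_antidiag_smul hgr' d

/-! ### §3 "mêmes nombres de Betti" ⟹ the same string lengths occur -/

omit [CharZero K] in
/-- `dim P_{-k} = dim M_{-k} - dim M_{-k-2}` (skel-1 A1-113 `finrank_degreeSpace_neg_eq_add`, rearranged).
[cite: Andre1996Motifs, Remark after Prop. 1.2 (p. 12, "l'hypothèse sur H' entraîne que dim Pⁱ(X) = dim P'ⁱ(X)")]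
[cite: LooijengaLunts1997, §1 (1.15)] -/
theorem finrank_primitiveSpace_eq_sub (L : HasLefschetzProperty h e) (k : ℕ) :
    finrank K ↥(primitiveSpace h e k) = finrank K ↥(degreeSpace h (-(k : ℤ))) - finrank K ↥(degreeSpace h (-((k : ℤ) + 2))) := by
  rw [finrank_degreeSpace_neg_eq_add L k, Nat.add_sub_cancel]

/-- **Equal primitive dimensions ⟹ the same string lengths occur.** [cite: Andre1996Motifs, Remark after Prop. 1.2 (p. 12)] -/
theorem stringTypes_eq_of_finrank_primitiveSpace_eq (L : HasLefschetzProperty h e) (L' : HasLefschetzProperty h' e')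
    (hP : ∀ k : ℕ, finrank K ↥(primitiveSpace h e k) = finrank K ↥(primitiveSpace h' e' k)) :
    stringTypes h e = stringTypes h' e' := by
  ext k
  rw [L.mem_stringTypes_iff, L'.mem_stringTypes_iff, Ne, Ne, ← Submodule.finrank_eq_zero, ← Submodule.finrank_eq_zero, hP k]

/-- **"ayant les mêmes nombres de Betti […] entraîne que `dim Pⁱ(X) = dim P'ⁱ(X)`"**: equal dimensions of all graded pieces ⟹ the same
string lengths occur, so that `kleimanAlgebraCongr` applies. [cite: Andre1996Motifs, Remark after Prop. 1.2 (p. 12)] -/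
theorem stringTypes_eq_of_finrank_degreeSpace_eq (L : HasLefschetzProperty h e) (L' : HasLefschetzProperty h' e')
    (hB : ∀ m : ℤ, finrank K ↥(degreeSpace h m) = finrank K ↥(degreeSpace h' m)) :
    stringTypes h e = stringTypes h' e' :=
  L.stringTypes_eq_of_finrank_primitiveSpace_eq L' fun k ↦ by
    rw [L.finrank_primitiveSpace_eq_sub k, L'.finrank_primitiveSpace_eq_sub k, hB, hB]

/-! ### §4 "la flèche verticale est donnée par `L ↦ L'`, `*_L ↦ *_{L'}`": uniqueness of the comparison arrow -/

omit [CharZero K] [FiniteDimensional K M] in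
/-- Inside `K[s]` (as a type), the generators `s` generate everything. [cite: Andre1996Motifs, Remark after Prop. 1.2 (p. 12)] -/
theorem adjoin_preimage_val_eq_top (s : Set (Module.End K M)) :
    Algebra.adjoin K ((Subtype.val : ↥(Algebra.adjoin K s) → Module.End K M) ⁻¹' s) = ⊤ := by
  refine Algebra.eq_top_iff.2 fun x ↦ ?_
  obtain ⟨x, hx⟩ := x
  refine Algebra.adjoin_induction (hx := hx) (fun y hy ↦ ?_) (fun r ↦ ?_) (fun y z hy hz ihy ihz ↦ ?_) (fun y z hy hz ihy ihz ↦ ?_)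
  · exact Algebra.subset_adjoin hy
  · exact Subalgebra.algebraMap_mem _ r
  · exact Subalgebra.add_mem _ ihy ihz
  · exact Subalgebra.mul_mem _ ihy ihz

omit [CharZero K] [FiniteDimensional K M] in
/-- **Two algebra maps out of `K[e, ᶜΛ]` which agree on `e` and on `ᶜΛ` are equal.** [cite: Andre1996Motifs, Remark after Prop. 1.2 (p. 12)] -/
theorem algHom_ext_of_apply_pair_eq {B : Type*} [Semiring B] [Algebra K B] {u v : Module.End K M}
    {φ ψ : ↥(Algebra.adjoin K ({u, v} : Set (Module.End K M))) →ₐ[K] B}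
    (hu : φ ⟨u, Algebra.subset_adjoin (Set.mem_insert _ _)⟩ = ψ ⟨u, Algebra.subset_adjoin (Set.mem_insert _ _)⟩)
    (hv : φ ⟨v, Algebra.subset_adjoin (Set.mem_insert_of_mem _ rfl)⟩ = ψ ⟨v, Algebra.subset_adjoin (Set.mem_insert_of_mem _ rfl)⟩) :
    φ = ψ := by
  refine AlgHom.ext_of_adjoin_eq_top (adjoin_preimage_val_eq_top ({u, v} : Set (Module.End K M))) fun x hx ↦ ?_
  obtain ⟨x, hxA⟩ := x
  rcases hx with hxu | hxv
  · rw [show (⟨x, hxA⟩ : ↥(Algebra.adjoin K ({u, v} : Set (Module.End K M)))) = ⟨u, Algebra.subset_adjoin (Set.mem_insert _ _)⟩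
      from Subtype.ext hxu]
    exact hu
  · rw [show (⟨x, hxA⟩ : ↥(Algebra.adjoin K ({u, v} : Set (Module.End K M)))) =
      ⟨v, Algebra.subset_adjoin (Set.mem_insert_of_mem _ rfl)⟩ from Subtype.ext hxv]
    exact hv

/-- **An algebra map out of `K[e, ᶜΛ]` is determined by its values on `e` and `*_L`** (`K[e, *_L] = K[e, ᶜΛ]`, row g30-#1).
[cite: Andre1996Motifs, Remark after Prop. 1.2 (p. 12)] -/
theorem algHom_ext_of_apply_e_lefschetzInvolution_eq (L : HasLefschetzProperty h e) (hgr : IsZGrading h) {B : Type*} [Semiring B]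
    [Algebra K B] {φ ψ : ↥(Algebra.adjoin K ({e, L.dual hgr} : Set (Module.End K M))) →ₐ[K] B}
    (he : φ ⟨e, Algebra.subset_adjoin (Set.mem_insert _ _)⟩ = ψ ⟨e, Algebra.subset_adjoin (Set.mem_insert _ _)⟩)
    (hs : φ ⟨L.lefschetzInvolution hgr, L.lefschetzInvolution_mem_adjoin_pair_dual hgr⟩ =
      ψ ⟨L.lefschetzInvolution hgr, L.lefschetzInvolution_mem_adjoin_pair_dual hgr⟩) : φ = ψ := by
  -- `{e, *_L}` also generates `K[e, ᶜΛ]` (as a type)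
  have hAA := L.adjoin_pair_lefschetzInvolution_eq_adjoin_pair_dual hgr
  have htop : Algebra.adjoin K ((Subtype.val : ↥(Algebra.adjoin K ({e, L.dual hgr} : Set (Module.End K M))) → Module.End K M) ⁻¹'
      ({e, L.lefschetzInvolution hgr} : Set (Module.End K M))) = ⊤ := by
    refine Algebra.eq_top_iff.2 fun x ↦ ?_
    obtain ⟨x, hx⟩ := x
    have hx' : x ∈ Algebra.adjoin K ({e, L.lefschetzInvolution hgr} : Set (Module.End K M)) := by rwa [hAA]
    suffices h : ∀ hxA : x ∈ Algebra.adjoin K ({e, L.dual hgr} : Set (Module.End K M)),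
        (⟨x, hxA⟩ : ↥(Algebra.adjoin K ({e, L.dual hgr} : Set (Module.End K M)))) ∈
          Algebra.adjoin K ((Subtype.val : ↥(Algebra.adjoin K ({e, L.dual hgr} : Set (Module.End K M))) → Module.End K M) ⁻¹'
            ({e, L.lefschetzInvolution hgr} : Set (Module.End K M))) from h hx
    refine Algebra.adjoin_induction (hx := hx') (fun y hy _ ↦ ?_) (fun r _ ↦ ?_) (fun y z hy hz ihy ihz _ ↦ ?_)
      (fun y z hy hz ihy ihz _ ↦ ?_)
    · exact Algebra.subset_adjoin hy
    · exact Subalgebra.algebraMap_mem _ r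
    · exact Subalgebra.add_mem _ (ihy (by rw [← hAA]; exact hy)) (ihz (by rw [← hAA]; exact hz))
    · exact Subalgebra.mul_mem _ (ihy (by rw [← hAA]; exact hy)) (ihz (by rw [← hAA]; exact hz))
  refine AlgHom.ext_of_adjoin_eq_top htop fun x hx ↦ ?_
  obtain ⟨x, hxA⟩ := x
  rcases hx with hxu | hxv
  · rw [show (⟨x, hxA⟩ : ↥(Algebra.adjoin K ({e, L.dual hgr} : Set (Module.End K M)))) =
      ⟨e, Algebra.subset_adjoin (Set.mem_insert _ _)⟩ from Subtype.ext hxu]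
    exact he
  · rw [show (⟨x, hxA⟩ : ↥(Algebra.adjoin K ({e, L.dual hgr} : Set (Module.End K M)))) =
      ⟨L.lefschetzInvolution hgr, L.lefschetzInvolution_mem_adjoin_pair_dual hgr⟩ from Subtype.ext hxv]
    exact hs

/-- **"la flèche verticale est DONNÉE par `L ↦ L'`, `*_L ↦ *_{L'}`": André's comparison isomorphism is the unique algebra map
`K[e, ᶜΛ] → K[e', ᶜΛ']` with these two values.** [cite: Andre1996Motifs, Remark after Prop. 1.2 (p. 12)] -/
theorem kleimanAlgebraCongr_unique (L : HasLefschetzProperty h e) (hgr : IsZGrading h) (L' : HasLefschetzProperty h' e')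
    (hgr' : IsZGrading h') (hst : stringTypes h e = stringTypes h' e')
    (ψ : ↥(Algebra.adjoin K ({e, L.dual hgr} : Set (Module.End K M))) →ₐ[K]
      ↥(Algebra.adjoin K ({e', L'.dual hgr'} : Set (Module.End K M'))))
    (he : (ψ ⟨e, Algebra.subset_adjoin (Set.mem_insert _ _)⟩ : Module.End K M') = e')
    (hs : (ψ ⟨L.lefschetzInvolution hgr, L.lefschetzInvolution_mem_adjoin_pair_dual hgr⟩ : Module.End K M') =
      L'.lefschetzInvolution hgr') :
    ψ = (L.kleimanAlgebraCongr hgr L' hgr' hst : _ →ₐ[K] _) := by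
  refine L.algHom_ext_of_apply_e_lefschetzInvolution_eq hgr (Subtype.ext ?_) (Subtype.ext ?_)
  · rw [he]; exact (L.coe_kleimanAlgebraCongr_e hgr L' hgr' hst).symm
  · rw [hs]; exact (L.coe_kleimanAlgebraCongr_lefschetzInvolution hgr L' hgr' hst).symm

/-- The same uniqueness with André's other generator pair `e`, `ᶜΛ`. [cite: Andre1996Motifs, Remark after Prop. 1.2 (p. 12)] -/
theorem kleimanAlgebraCongr_unique' (L : HasLefschetzProperty h e) (hgr : IsZGrading h) (L' : HasLefschetzProperty h' e')
    (hgr' : IsZGrading h') (hst : stringTypes h e = stringTypes h' e')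
    (ψ : ↥(Algebra.adjoin K ({e, L.dual hgr} : Set (Module.End K M))) →ₐ[K]
      ↥(Algebra.adjoin K ({e', L'.dual hgr'} : Set (Module.End K M'))))
    (he : (ψ ⟨e, Algebra.subset_adjoin (Set.mem_insert _ _)⟩ : Module.End K M') = e')
    (hd : (ψ ⟨L.dual hgr, Algebra.subset_adjoin (Set.mem_insert_of_mem _ rfl)⟩ : Module.End K M') = L'.dual hgr') :
    ψ = (L.kleimanAlgebraCongr hgr L' hgr' hst : _ →ₐ[K] _) := by
  refine algHom_ext_of_apply_pair_eq (Subtype.ext ?_) (Subtype.ext ?_)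
  · rw [he]; exact (L.coe_kleimanAlgebraCongr_e hgr L' hgr' hst).symm
  · rw [hd]; exact (L.coe_kleimanAlgebraCongr_dual hgr L' hgr' hst).symm

end HasLefschetzProperty

end Literature.Algebra.Lie

end
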